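import Literature.NumberTheory.Sieve.HeathBrownCubicWindow
import Mathlib.Analysis.SpecialFunctions.Complex.Arg
import Mathlib.Analysis.SpecialFunctions.Complex.Circle
import Mathlib.Analysis.SpecialFunctions.Pow.Real
import HarnessLib

/-!
# Polar coordinates for `ℚ(∛2) ⊗ ℝ = ℝ × ℂ`: the complex embedding, the unit flow and sectors

Support (all PROVED; definitions with bodies, no named facts) for the **twisted ideal counts** of
`K = ℚ(∛2)` — `∑_{N𝔞 ≤ x} ν(𝔞)` for Hecke characters `ν` (a character `mod q` times a
Grössencharakter), the input "Lemma 9.4" (T. Mitsui's prime number theorem with Grössencharakteren,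
Jap. J. Math. 26 (1956), Lemma 5) of D. R. Heath-Brown, *Primes represented by `x³ + 2y³`*, Acta Math.
186 (2001), §9 — through the continuation files `LSeriesContinuationOfPartialSums`,
`TwistedZeroFreeRegion`, `LogRieszMeanConductor` (`Literature/NumberTheory/LFunctions`).

Heath-Brown (p. 53) writes `β = x₁ + x₂∛2 + x₃∛4` (real embedding) and
`β' = x₁ + x₂ω∛2 + x₃ω²∛4` (complex embedding), and his Grössencharaktere (9.2)
`ν₁(β) = (β'/|β'|) exp(−iu v⁻¹ log|β|)`, `ν₂(β) = exp(−2πi v⁻¹ log|β|)` (`v = log ε₀`) are functions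
of the **angle** `arg β'` and of the **unit coordinate** `log(β/N(β)^{1/3})/log ε₀`. This file sets up
these coordinates on `W = ℝ × ℂ` (continuing `HeathBrownCubicWindow`, which has the real embedding
`ell`, `quadQ = |β'|²`, the unit size `E = unitE` and the window of generators):

* `cplxEmb p = β'` for a coordinate vector `p ∈ ℝ³` (`normSq_cplxEmb : |β'|² = quadQ`,
  `ell_mul_normSq_cplxEmb : β·|β'|² = N`), and the `ℝ`-linear **Minkowski embedding**
  `embW p = (ell p, cplxEmb p) : ℝ³ →ₗ W`, injective (`embW_injective`);
* on `W`: `wNorm w = w₁|w₂|²`, and for `w₁ > 0`, `w₂ ≠ 0` the polar coordinates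
  `wU w = N^{1/3}`, `wR w = log(w₁/N^{1/3})/log E`, `arg w₂`;
* the **polar map** `polarMap (u, r, φ) = (u E^r, u E^{−r/2} e^{iφ})` (smooth: `contDiff_polarMap`),
  with `wNorm ∘ polarMap = u³`, `wU ∘ polarMap = u`, `wR ∘ polarMap = r`, `arg = φ`
  (`u > 0`, `φ ∈ (−π, π]`), and conversely `polarMap (wU w, wR w, arg w₂) = w` (`polarMap_wCoord`);
* the **sectors** `sector a b = polarMap '' ((0, 1] × [a, b])` (`a, b ∈ ℝ × ℝ`: a box of unit
  coordinates and angles), their membership criterion `mem_sector_iff` and boundedness.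

The unit flow `(w₁, w₂) ↦ (E^r w₁, E^{−r/2} w₂)` and the rotations `w₂ ↦ e^{iφ} w₂` map sectors to
sectors (`image_unitFlow_sector`, `image_rotate_sector`); both are volume preserving, which is how
the equality of the volumes of congruent sectors is obtained downstream (no Jacobians).

## References

* D. R. Heath-Brown, *Primes represented by `x³ + 2y³`*, Acta Math. 186 (2001), §9 p. 53, (9.2);
  §11 (11.3). [cite: HeathBrownActa2001, §9 (9.2)]
* E. Hecke, *Eine neue Art von Zetafunktionen und ihre Beziehungen zur Verteilung der Primzahlen.
  II*, Math. Z. 6 (1920), 11–51 (Grössencharaktere as characters of these coordinates). [folklore]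

## Mathlib / tree search

Tree: `HeathBrownCubicWindow` (`rho`, `ell`, `quadQ`, `ell_mul_quadQ`, `normForm`, `unitE`,
`one_lt_unitE`). Mathlib: `Complex.arg_real_mul`, `Complex.arg_exp_mul_I`?? — we use
`Complex.exp_mul_I`, `Complex.arg_cos_add_sin_mul_I`, `Complex.norm_mul_exp_arg_mul_I`,
`Real.rpow_natCast`, `Real.pow_rpow_inv_natCast`, `Complex.contDiff_exp`, `Real.contDiff_exp`.
No polar/sector coordinates for a cubic field existed (`lean search 'polarMap|Grössen|sector.*unit'`).
-/

noncomputable section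

open Complex Set

namespace Literature.NumberTheory.Sieve.CubicSieve

/-! ### The complex embedding `β' = x₁ + x₂ω∛2 + x₃ω²∛4` -/

/-- **The complex embedding** of a coordinate vector `p = (x₁, x₂, x₃)`:
`β' = x₁ + x₂ω∛2 + x₃ω²∛4`, `ω = e^{2πi/3} = −1/2 + i√3/2`, written through its real and imaginary
parts `x₁ − (ρx₂ + ρ²x₃)/2` and `(√3/2)(ρx₂ − ρ²x₃)` (`ρ = ∛2`). [cite: HeathBrownActa2001, §9 p. 53] -/
def cplxEmb (p : ℝ × ℝ × ℝ) : ℂ :=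
  ⟨p.1 - (rho * p.2.1 + rho ^ 2 * p.2.2) / 2, Real.sqrt 3 / 2 * (rho * p.2.1 - rho ^ 2 * p.2.2)⟩

/-- Real part of the complex embedding. [folklore] -/
@[simp] theorem cplxEmb_re (p : ℝ × ℝ × ℝ) :
    (cplxEmb p).re = p.1 - (rho * p.2.1 + rho ^ 2 * p.2.2) / 2 := rfl

/-- Imaginary part of the complex embedding. [folklore] -/
@[simp] theorem cplxEmb_im (p : ℝ × ℝ × ℝ) :
    (cplxEmb p).im = Real.sqrt 3 / 2 * (rho * p.2.1 - rho ^ 2 * p.2.2) := rfl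

/-- **`|β'|² = quadQ`**. [folklore] -/
theorem normSq_cplxEmb (p : ℝ × ℝ × ℝ) : Complex.normSq (cplxEmb p) = quadQ p := by
  have h3 : Real.sqrt 3 ^ 2 = 3 := Real.sq_sqrt (by norm_num)
  rw [Complex.normSq_apply, cplxEmb_re, cplxEmb_im, quadQ]
  linear_combination ((rho * p.2.1 - rho ^ 2 * p.2.2) ^ 2 / 4) * h3

/-- **`β · |β'|² = N(β)`**. [folklore] -/
theorem ell_mul_normSq_cplxEmb (p : ℝ × ℝ × ℝ) :
    ell p * Complex.normSq (cplxEmb p) = normForm p := by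
  rw [normSq_cplxEmb, ell_mul_quadQ]

/-- `cplxEmb` is additive. [folklore] -/
theorem cplxEmb_add (p q : ℝ × ℝ × ℝ) : cplxEmb (p + q) = cplxEmb p + cplxEmb q := by
  apply Complex.ext <;> simp <;> ring

/-- `cplxEmb` is homogeneous. [folklore] -/
theorem cplxEmb_smul (c : ℝ) (p : ℝ × ℝ × ℝ) : cplxEmb (c • p) = (c : ℂ) * cplxEmb p := by
  apply Complex.ext <;> simp <;> ring

/-- `ell` is additive. [folklore] -/
theorem ell_add (p q : ℝ × ℝ × ℝ) : ell (p + q) = ell p + ell q := by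
  simp [ell]; ring

/-- `ell` is homogeneous. [folklore] -/
theorem ell_smul (c : ℝ) (p : ℝ × ℝ × ℝ) : ell (c • p) = c * ell p := by
  simp [ell]; ring

/-- **The Minkowski embedding** of the coefficient space `ℝ³` into `W = ℝ × ℂ`:
`p ↦ (β, β') = (ell p, cplxEmb p)`, an `ℝ`-linear map. [cite: HeathBrownActa2001, §9 p. 53] -/
def embW : (ℝ × ℝ × ℝ) →ₗ[ℝ] ℝ × ℂ where
  toFun p := (ell p, cplxEmb p)
  map_add' p q := by
    refine Prod.ext ?_ ?_
    · simp only [Prod.fst_add, Prod.snd_add, ell]; ring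
    · apply Complex.ext <;> simp [cplxEmb] <;> ring
  map_smul' c p := by
    refine Prod.ext ?_ ?_
    · simp only [Prod.smul_fst, Prod.smul_snd, smul_eq_mul, RingHom.id_apply, ell]; ring
    · apply Complex.ext <;> simp [cplxEmb] <;> ring

/-- Unfolding of `embW`. [folklore] -/
@[simp] theorem embW_apply (p : ℝ × ℝ × ℝ) : embW p = (ell p, cplxEmb p) := rfl

/-- **`embW` is injective** (`β = β' = 0` forces `p = 0`: `Im β' = 0` gives `ρx₂ = ρ²x₃`, then
`Re β' = 0` gives `x₁ = ρx₂`, and `β = 3ρx₂ = 0`). [folklore] -/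
theorem embW_injective : Function.Injective embW := by
  intro p q hpq
  have h := sub_eq_zero.2 hpq
  rw [← map_sub] at h
  set d := p - q with hd
  have h1 : ell d = 0 := by have := congrArg Prod.fst h; simpa using this
  have h2 : (cplxEmb d).re = 0 := by have := congrArg Prod.snd h; simp at this; rw [this]; simp
  have h3 : (cplxEmb d).im = 0 := by have := congrArg Prod.snd h; simp at this; rw [this]; simp
  rw [cplxEmb_re] at h2
  rw [cplxEmb_im] at h3
  rw [ell] at h1
  have hs : Real.sqrt 3 ≠ 0 := Real.sqrt_ne_zero'.2 (by norm_num)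
  have hρ := rho_pos
  have e1 : rho * d.2.1 = rho ^ 2 * d.2.2 := by
    have : Real.sqrt 3 / 2 * (rho * d.2.1 - rho ^ 2 * d.2.2) = 0 := h3
    have h4 : rho * d.2.1 - rho ^ 2 * d.2.2 = 0 := by
      rcases mul_eq_zero.1 this with h | h
      · exact absurd h (by positivity)
      · exact h
    linarith
  have e2 : d.1 = rho * d.2.1 := by linarith
  have e3 : rho * d.2.1 = 0 := by linarith
  have hd2 : d.2.1 = 0 := by
    rcases mul_eq_zero.1 e3 with h | h
    · exact absurd h hρ.ne'
    · exact h
  have hd3 : d.2.2 = 0 := by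
    rw [hd2, mul_zero] at e1
    rcases mul_eq_zero.1 e1.symm with h | h
    · exact absurd h (by positivity)
    · exact h
  have hd1 : d.1 = 0 := by rw [e2, hd2, mul_zero]
  have : d = 0 := Prod.ext hd1 (Prod.ext hd2 hd3)
  rwa [hd, sub_eq_zero] at this

/-! ### The norm and the polar coordinates on `W = ℝ × ℂ` -/

/-- `N(w) = w₁ |w₂|²`, the norm form on `W`. [folklore] -/
def wNorm (w : ℝ × ℂ) : ℝ := w.1 * Complex.normSq w.2

/-- `N(embW p) = N(p)`. [folklore] -/
theorem wNorm_embW (p : ℝ × ℝ × ℝ) : wNorm (embW p) = normForm p := by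
  rw [wNorm, embW_apply, ell_mul_normSq_cplxEmb]

/-- `u(w) = N(w)^{1/3}`. [folklore] -/
def wU (w : ℝ × ℂ) : ℝ := wNorm w ^ ((1 : ℝ) / 3)

/-- `r(w) = log(w₁ / N(w)^{1/3}) / log E`, the unit coordinate (`E = unitE`).
[cite: HeathBrownActa2001, §11 (11.3)] -/
def wR (w : ℝ × ℂ) : ℝ := Real.log (w.1 / wU w) / Real.log unitE

/-- `log E > 0`. [folklore] -/
theorem log_unitE_pos : 0 < Real.log unitE := Real.log_pos one_lt_unitE

/-- `N(w) > 0` for `w₁ > 0`, `w₂ ≠ 0`. [folklore] -/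
theorem wNorm_pos {w : ℝ × ℂ} (h1 : 0 < w.1) (h2 : w.2 ≠ 0) : 0 < wNorm w :=
  mul_pos h1 (Complex.normSq_pos.2 h2)

/-- `u(w) > 0` for `w₁ > 0`, `w₂ ≠ 0`. [folklore] -/
theorem wU_pos {w : ℝ × ℂ} (h1 : 0 < w.1) (h2 : w.2 ≠ 0) : 0 < wU w :=
  Real.rpow_pos_of_pos (wNorm_pos h1 h2) _

/-- `u(w)³ = N(w)` for `w₁ > 0`, `w₂ ≠ 0`. [folklore] -/
theorem wU_pow_three {w : ℝ × ℂ} (h1 : 0 < w.1) (h2 : w.2 ≠ 0) : wU w ^ 3 = wNorm w := by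
  rw [wU, ← Real.rpow_natCast, ← Real.rpow_mul (wNorm_pos h1 h2).le]
  norm_num

/-! ### The polar map -/

/-- **The polar map** `(u, r, φ) ↦ (u E^r, u E^{−r/2} e^{iφ}) ∈ W` (`E^r` written as
`exp(r log E)`). [cite: HeathBrownActa2001, §9 (9.2)] -/
def polarMap (p : ℝ × ℝ × ℝ) : ℝ × ℂ :=
  (p.1 * Real.exp (Real.log unitE * p.2.1),
    ((p.1 * Real.exp (-(Real.log unitE * p.2.1) / 2) : ℝ) : ℂ) * Complex.exp ((p.2.2 : ℂ) * I))

/-- First coordinate of `polarMap`. [folklore] -/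
@[simp] theorem polarMap_fst (p : ℝ × ℝ × ℝ) :
    (polarMap p).1 = p.1 * Real.exp (Real.log unitE * p.2.1) := rfl

/-- Second coordinate of `polarMap`. [folklore] -/
@[simp] theorem polarMap_snd (p : ℝ × ℝ × ℝ) :
    (polarMap p).2 = ((p.1 * Real.exp (-(Real.log unitE * p.2.1) / 2) : ℝ) : ℂ) *
      Complex.exp ((p.2.2 : ℂ) * I) := rfl

/-- **The polar map is smooth.** [folklore] -/
theorem contDiff_polarMap {n : WithTop ℕ∞} : ContDiff ℝ n polarMap := by
  unfold polarMap
  refine ContDiff.prodMk ?_ ?_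
  · exact contDiff_fst.mul (Real.contDiff_exp.comp (contDiff_const.mul (contDiff_fst.comp contDiff_snd)))
  · refine ContDiff.mul ?_ ?_
    · refine Complex.ofRealCLM.contDiff.comp ?_
      exact contDiff_fst.mul (Real.contDiff_exp.comp
        ((contDiff_const.mul (contDiff_fst.comp contDiff_snd)).neg.div_const 2))
    · refine Complex.contDiff_exp.comp ?_
      exact (Complex.ofRealCLM.contDiff.comp (contDiff_snd.comp contDiff_snd)).mul contDiff_const

/-- `polarMap` is continuous. [folklore] -/
theorem continuous_polarMap : Continuous polarMap := contDiff_polarMap (n := 0) |>.continuous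

/-- `|e^{iφ}|² = 1` for real `φ`. [folklore] -/
theorem normSq_exp_mul_I (φ : ℝ) : Complex.normSq (Complex.exp ((φ : ℂ) * I)) = 1 := by
  rw [Complex.normSq_eq_norm_sq, Complex.norm_exp_ofReal_mul_I, one_pow]

/-- **`N(polarMap (u, r, φ)) = u³`.** [folklore] -/
theorem wNorm_polarMap (p : ℝ × ℝ × ℝ) : wNorm (polarMap p) = p.1 ^ 3 := by
  rw [wNorm, polarMap_fst, polarMap_snd, Complex.normSq_mul, Complex.normSq_ofReal, normSq_exp_mul_I,
    mul_one]
  have h : Real.exp (Real.log unitE * p.2.1) * (Real.exp (-(Real.log unitE * p.2.1) / 2) *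
      Real.exp (-(Real.log unitE * p.2.1) / 2)) = 1 := by
    rw [← Real.exp_add, ← Real.exp_add]
    convert Real.exp_zero using 2
    ring
  calc p.1 * Real.exp (Real.log unitE * p.2.1) *
        (p.1 * Real.exp (-(Real.log unitE * p.2.1) / 2) * (p.1 * Real.exp (-(Real.log unitE * p.2.1) / 2)))
      = p.1 ^ 3 * (Real.exp (Real.log unitE * p.2.1) * (Real.exp (-(Real.log unitE * p.2.1) / 2) *
          Real.exp (-(Real.log unitE * p.2.1) / 2))) := by ring
    _ = p.1 ^ 3 := by rw [h, mul_one]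

/-- The first coordinate of `polarMap (u, r, φ)` is positive for `u > 0`. [folklore] -/
theorem polarMap_fst_pos {p : ℝ × ℝ × ℝ} (hu : 0 < p.1) : 0 < (polarMap p).1 := by
  rw [polarMap_fst]; positivity

/-- The second coordinate of `polarMap (u, r, φ)` is nonzero for `u > 0`. [folklore] -/
theorem polarMap_snd_ne_zero {p : ℝ × ℝ × ℝ} (hu : 0 < p.1) : (polarMap p).2 ≠ 0 := by
  rw [polarMap_snd]
  refine mul_ne_zero ?_ (Complex.exp_ne_zero _)
  exact_mod_cast (by positivity : p.1 * Real.exp (-(Real.log unitE * p.2.1) / 2) ≠ 0)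

/-- **`u(polarMap (u, r, φ)) = u`** for `u ≥ 0`. [folklore] -/
theorem wU_polarMap {p : ℝ × ℝ × ℝ} (hu : 0 ≤ p.1) : wU (polarMap p) = p.1 := by
  rw [wU, wNorm_polarMap, ← Real.rpow_natCast, ← Real.rpow_mul hu]
  norm_num

/-- **`r(polarMap (u, r, φ)) = r`** for `u > 0`. [folklore] -/
theorem wR_polarMap {p : ℝ × ℝ × ℝ} (hu : 0 < p.1) : wR (polarMap p) = p.2.1 := by
  rw [wR, wU_polarMap hu.le, polarMap_fst, mul_comm p.1, mul_div_assoc, div_self hu.ne', mul_one,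
    Real.log_exp, mul_div_cancel_left₀ _ log_unitE_pos.ne']

/-- **`arg (polarMap (u, r, φ))₂ = φ`** for `u > 0`, `φ ∈ (−π, π]`. [folklore] -/
theorem arg_polarMap_snd {p : ℝ × ℝ × ℝ} (hu : 0 < p.1) (hφ : p.2.2 ∈ Set.Ioc (-Real.pi) Real.pi) :
    Complex.arg (polarMap p).2 = p.2.2 := by
  rw [polarMap_snd, Complex.arg_real_mul _ (by positivity), Complex.exp_mul_I,
    Complex.arg_cos_add_sin_mul_I hφ]

/-- **Conversely, `polarMap (u(w), r(w), arg w₂) = w`** for `w₁ > 0`, `w₂ ≠ 0`. [folklore] -/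
theorem polarMap_wCoord {w : ℝ × ℂ} (h1 : 0 < w.1) (h2 : w.2 ≠ 0) :
    polarMap (wU w, wR w, Complex.arg w.2) = w := by
  have hu := wU_pos h1 h2
  have hℓ := log_unitE_pos
  have hdiv : 0 < w.1 / wU w := div_pos h1 hu
  -- `exp(log E · r) = w₁/u`
  have hexp : Real.exp (Real.log unitE * wR w) = w.1 / wU w := by
    rw [wR, mul_div_cancel₀ _ hℓ.ne', Real.exp_log hdiv]
  have hfst : wU w * Real.exp (Real.log unitE * wR w) = w.1 := by
    rw [hexp, mul_div_cancel₀ _ hu.ne']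
  -- the modulus: `u · (w₁/u)^{-1/2} = |w₂|`
  have hN : wU w ^ 3 = w.1 * Complex.normSq w.2 := wU_pow_three h1 h2
  have hmod : wU w * Real.exp (-(Real.log unitE * wR w) / 2) = ‖w.2‖ := by
    have hsq : (wU w * Real.exp (-(Real.log unitE * wR w) / 2)) ^ 2 = ‖w.2‖ ^ 2 := by
      have e1 : Real.exp (-(Real.log unitE * wR w) / 2) ^ 2 = (w.1 / wU w)⁻¹ := by
        rw [← Real.exp_nat_mul, show ((2 : ℕ) : ℝ) * (-(Real.log unitE * wR w) / 2) =
          -(Real.log unitE * wR w) by push_cast; ring, Real.exp_neg, hexp]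
      rw [mul_pow, e1, ← Complex.normSq_eq_norm_sq, inv_div]
      field_simp
      nlinarith [hN]
    have h0 : 0 ≤ wU w * Real.exp (-(Real.log unitE * wR w) / 2) := by positivity
    exact (pow_left_inj₀ h0 (norm_nonneg _) two_ne_zero).1 hsq
  apply Prod.ext
  · rw [polarMap_fst]; exact hfst
  · rw [polarMap_snd]
    simp only
    rw [hmod]
    exact Complex.norm_mul_exp_arg_mul_I w.2

/-! ### Sectors -/

/-- **The sector** with unit coordinates and angles in the box `[a, b] ⊆ ℝ²` and norm in `(0, 1]`:
`sector a b = polarMap '' ((0, 1] × [a, b])`. [cite: HeathBrownActa2001, §11 (11.3)] -/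
def sector (a b : ℝ × ℝ) : Set (ℝ × ℂ) := polarMap '' (Set.Ioc (0 : ℝ) 1 ×ˢ Set.Icc a b)

/-- **Membership in a sector through the coordinates** (angles within `(−π, π]`): `w ∈ sector a b`
iff `w₁ > 0`, `w₂ ≠ 0`, `N(w) ≤ 1`, `r(w) ∈ [a₁, b₁]`, `arg w₂ ∈ [a₂, b₂]`. [folklore] -/
theorem mem_sector_iff {a b : ℝ × ℝ} (ha : -Real.pi < a.2) (hb : b.2 ≤ Real.pi) {w : ℝ × ℂ} :
    w ∈ sector a b ↔ 0 < w.1 ∧ w.2 ≠ 0 ∧ wNorm w ≤ 1 ∧ wR w ∈ Set.Icc a.1 b.1 ∧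
      Complex.arg w.2 ∈ Set.Icc a.2 b.2 := by
  constructor
  · rintro ⟨p, ⟨hu, hbox⟩, rfl⟩
    rw [Set.mem_Icc] at hbox
    have hφ : p.2.2 ∈ Set.Ioc (-Real.pi) Real.pi := ⟨ha.trans_le hbox.1.2, hbox.2.2.trans hb⟩
    refine ⟨polarMap_fst_pos hu.1, polarMap_snd_ne_zero hu.1, ?_, ?_, ?_⟩
    · rw [wNorm_polarMap]; exact pow_le_one₀ hu.1.le hu.2
    · rw [wR_polarMap hu.1]; exact ⟨hbox.1.1, hbox.2.1⟩
    · rw [arg_polarMap_snd hu.1 hφ]; exact ⟨hbox.1.2, hbox.2.2⟩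
  · rintro ⟨h1, h2, hN, hr, hφ⟩
    refine ⟨(wU w, wR w, Complex.arg w.2), ⟨⟨wU_pos h1 h2, ?_⟩, ?_⟩, polarMap_wCoord h1 h2⟩
    · have h3 := wU_pow_three h1 h2
      by_contra hcon
      rw [not_le] at hcon
      have : 1 < wU w ^ 3 := by
        calc (1 : ℝ) = 1 ^ 3 := by norm_num
          _ < wU w ^ 3 := by gcongr
      linarith
    · exact ⟨⟨hr.1, hφ.1⟩, ⟨hr.2, hφ.2⟩⟩

/-- Sectors are bounded (contained in the continuous image of a compact box). [folklore] -/
theorem isBounded_sector (a b : ℝ × ℝ) : Bornology.IsBounded (sector a b) := by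
  have hc : IsCompact (polarMap '' (Set.Icc (0 : ℝ) 1 ×ˢ Set.Icc a b)) :=
    (isCompact_Icc.prod isCompact_Icc).image continuous_polarMap
  refine hc.isBounded.subset (Set.image_mono ?_)
  exact Set.prod_mono Set.Ioc_subset_Icc_self subset_rfl

/-- Sectors lie in the closed image `polarMap '' ([0, 1] × [a, b])`. [folklore] -/
theorem sector_subset_image_Icc (a b : ℝ × ℝ) :
    sector a b ⊆ polarMap '' (Set.Icc (0 : ℝ) 1 ×ˢ Set.Icc a b) :=
  Set.image_mono (Set.prod_mono Set.Ioc_subset_Icc_self subset_rfl)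

/-! ### The unit flow and the rotations -/

/-- **The unit flow** `(w₁, w₂) ↦ (E^{r₀} w₁, E^{−r₀/2} w₂)` on `W` (for `r₀ ∈ ℤ` and `E = ε₀` this is
multiplication by the unit `ε₀^{r₀}`; Heath-Brown's matrix `M`, p. 53), an `ℝ`-linear map.
[cite: HeathBrownActa2001, §9 p. 53] -/
def unitFlow (r₀ : ℝ) : (ℝ × ℂ) →ₗ[ℝ] ℝ × ℂ :=
  (Real.exp (Real.log unitE * r₀) • LinearMap.id).prodMap
    (Real.exp (-(Real.log unitE * r₀) / 2) • LinearMap.id)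

/-- Unfolding of `unitFlow`. [folklore] -/
@[simp] theorem unitFlow_apply (r₀ : ℝ) (w : ℝ × ℂ) :
    unitFlow r₀ w = (Real.exp (Real.log unitE * r₀) * w.1,
      (Real.exp (-(Real.log unitE * r₀) / 2) : ℝ) • w.2) := by
  simp [unitFlow]

/-- **The rotation** `(w₁, w₂) ↦ (w₁, e^{iφ₀} w₂)` on `W`, an `ℝ`-linear map. [folklore] -/
def rotW (φ₀ : ℝ) : (ℝ × ℂ) →ₗ[ℝ] ℝ × ℂ :=
  LinearMap.id.prodMap
    ((Complex.exp ((φ₀ : ℂ) * I) • (LinearMap.id : ℂ →ₗ[ℂ] ℂ)).restrictScalars ℝ)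

/-- Unfolding of `rotW`. [folklore] -/
@[simp] theorem rotW_apply (φ₀ : ℝ) (w : ℝ × ℂ) :
    rotW φ₀ w = (w.1, Complex.exp ((φ₀ : ℂ) * I) * w.2) := by
  simp [rotW]

/-- **Shifting the unit coordinate is the unit flow**:
`polarMap (u, r + r₀, φ) = unitFlow r₀ (polarMap (u, r, φ))`. [folklore] -/
theorem polarMap_add_r (u r r₀ φ : ℝ) :
    polarMap (u, r + r₀, φ) = unitFlow r₀ (polarMap (u, r, φ)) := by
  rw [unitFlow_apply]
  apply Prod.ext
  · simp only [polarMap_fst, mul_add, Real.exp_add]; ring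
  · simp only [polarMap_snd, Complex.real_smul]
    have : Real.exp (-(Real.log unitE * (r + r₀)) / 2) =
        Real.exp (-(Real.log unitE * r₀) / 2) * Real.exp (-(Real.log unitE * r) / 2) := by
      rw [← Real.exp_add]; congr 1; ring
    rw [this]; push_cast; ring

/-- **Shifting the angle is a rotation**: `polarMap (u, r, φ + φ₀) = rotW φ₀ (polarMap (u, r, φ))`.
[folklore] -/
theorem polarMap_add_φ (u r φ φ₀ : ℝ) :
    polarMap (u, r, φ + φ₀) = rotW φ₀ (polarMap (u, r, φ)) := by
  rw [rotW_apply]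
  apply Prod.ext
  · simp only [polarMap_fst]
  · simp only [polarMap_snd]
    have : Complex.exp (((φ + φ₀ : ℝ) : ℂ) * I) = Complex.exp ((φ₀ : ℂ) * I) * Complex.exp ((φ : ℂ) * I) := by
      rw [← Complex.exp_add]; congr 1; push_cast; ring
    rw [this]; ring

/-- **The unit flow maps sectors to sectors**: `unitFlow r₀ '' sector a b = sector (a + (r₀,0)) (b + (r₀,0))`.
[folklore] -/
theorem image_unitFlow_sector (r₀ : ℝ) (a b : ℝ × ℝ) :
    unitFlow r₀ '' sector a b = sector (a + (r₀, 0)) (b + (r₀, 0)) := by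
  unfold sector
  rw [Set.image_image]
  ext w
  simp only [Set.mem_image, Set.mem_prod, Set.mem_Ioc, Set.mem_Icc, Prod.exists]
  constructor
  · rintro ⟨u, r, φ, ⟨hu, hrφ⟩, rfl⟩
    refine ⟨u, r + r₀, φ, ⟨hu, ?_⟩, ?_⟩
    · simp only [Prod.le_def, Prod.fst_add, Prod.snd_add, add_zero] at hrφ ⊢
      exact ⟨⟨by linarith [hrφ.1.1], hrφ.1.2⟩, ⟨by linarith [hrφ.2.1], hrφ.2.2⟩⟩
    · rw [polarMap_add_r]
  · rintro ⟨u, r, φ, ⟨hu, hrφ⟩, rfl⟩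
    refine ⟨u, r - r₀, φ, ⟨hu, ?_⟩, ?_⟩
    · simp only [Prod.le_def, Prod.fst_add, Prod.snd_add, add_zero] at hrφ ⊢
      exact ⟨⟨by linarith [hrφ.1.1], hrφ.1.2⟩, ⟨by linarith [hrφ.2.1], hrφ.2.2⟩⟩
    · rw [← polarMap_add_r, sub_add_cancel]

/-- **Rotations map sectors to sectors**: `rotW φ₀ '' sector a b = sector (a + (0,φ₀)) (b + (0,φ₀))`.
[folklore] -/
theorem image_rotW_sector (φ₀ : ℝ) (a b : ℝ × ℝ) :
    rotW φ₀ '' sector a b = sector (a + (0, φ₀)) (b + (0, φ₀)) := by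
  unfold sector
  rw [Set.image_image]
  ext w
  simp only [Set.mem_image, Set.mem_prod, Set.mem_Ioc, Set.mem_Icc, Prod.exists]
  constructor
  · rintro ⟨u, r, φ, ⟨hu, hrφ⟩, rfl⟩
    refine ⟨u, r, φ + φ₀, ⟨hu, ?_⟩, ?_⟩
    · simp only [Prod.le_def, Prod.fst_add, Prod.snd_add, add_zero] at hrφ ⊢
      exact ⟨⟨hrφ.1.1, by linarith [hrφ.1.2]⟩, ⟨hrφ.2.1, by linarith [hrφ.2.2]⟩⟩
    · rw [polarMap_add_φ]
  · rintro ⟨u, r, φ, ⟨hu, hrφ⟩, rfl⟩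
    refine ⟨u, r, φ - φ₀, ⟨hu, ?_⟩, ?_⟩
    · simp only [Prod.le_def, Prod.fst_add, Prod.snd_add, add_zero] at hrφ ⊢
      exact ⟨⟨hrφ.1.1, by linarith [hrφ.1.2]⟩, ⟨hrφ.2.1, by linarith [hrφ.2.2]⟩⟩
    · rw [← polarMap_add_φ, sub_add_cancel]

/-- **The unit flow preserves volume**: `det (unitFlow r₀) = E^{r₀} · (E^{−r₀/2})² = 1`. [folklore] -/
theorem det_unitFlow (r₀ : ℝ) : LinearMap.det (unitFlow r₀) = 1 := by
  rw [unitFlow, LinearMap.det_prodMap, LinearMap.det_smul, LinearMap.det_smul, LinearMap.det_id,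
    LinearMap.det_id, Module.finrank_self, Complex.finrank_real_complex, mul_one, mul_one, pow_one,
    ← Real.exp_nat_mul, ← Real.exp_add]
  convert Real.exp_zero using 2
  push_cast; ring

/-- **Rotations preserve volume**: `det (rotW φ₀) = |e^{iφ₀}|² = 1`. [folklore] -/
theorem det_rotW (φ₀ : ℝ) : LinearMap.det (rotW φ₀) = 1 := by
  rw [rotW, LinearMap.det_prodMap, LinearMap.det_id, one_mul, LinearMap.det_restrictScalars,
    LinearMap.det_smul, LinearMap.det_id, mul_one, Module.finrank_self, pow_one,
    Algebra.norm_complex_apply, normSq_exp_mul_I]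

end Literature.NumberTheory.Sieve.CubicSieve
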